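import Summits.MatrixMultiplication.MatrixMultiplication.Theorems.AbelianSTPPCensusFPQGenSound

/-!
# Rule FPq-cyc is SOUND for every squarefree `q`: `IsSTPP ⇒ FPQ.AdmC q |H|`

Cell mm-stpp (rung F-M1), theory lane «past the walls» (seat mm-stpp-theory, gen 18).  The shape-level predicate `FPQ.AdmC q M`
(`AbelianSTPPCensusFPQCycDefs`: class counts indexed by the CYCLIC group `ℤ/q`) holds on the shape data of every STPP family with non-empty
sets in a finite abelian group `H` of order `M`, for every SQUAREFREE `q` (`FPQ.admC_of_isSTPP`, item format `FPQ.fpqCycSound`, certificate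
bridge `FPQ.no_isSTPP_of_not_admC`).  Examples: `q = 55` at `605 = 55·11`, `q = 6` at `606 = 6·101`, `q = 85` at `3655 = 85·43`
(HOME/mm-stpp-theory/FPQ-NOTE.md).

PROOF.  Nothing to show unless `|H| = q·p` with `p` prime.  Then an element of order `p` (Cauchy) generates a subgroup `P` with `p` elements;
the quotient `H ⧸ P` is abelian of squarefree order `q`, hence CYCLIC — `FPQ.isAddCyclic_of_squarefree_card`: the exponent divides the
order, is divisible by every prime factor of the order (Cauchy), and a squarefree number divides every number that all its primes divide —
so `H ⧸ P ≃+ ℤ/q` (`FPQ.exists_quotient_equiv_zmod`).  The general soundness theorem for an arbitrary label group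
(`FPQ.admG_of_isSTPP`, `AbelianSTPPCensusFPQGenSound`, with `FPQ.nonempty_genLab`) gives `AdmG (ZMod q)`, which is `AdmC q`
(`FPQ.admC_iff_admG`).
WHAT THIS IS NOT: no census number, no checker, no `ω` statement — a necessary condition; silent unless `|H| = q·p`, `p` prime, `q` squarefree.
References: J. M. Pollard, J. London Math. Soc. (2) 8 (1974) 460–462 (tree `Literature.Combinatorics.Additive.pollard`); CKSU 2005 Def. 5.1.
-/

set_option linter.dupNamespace false -- `MatrixMultiplication.MatrixMultiplication` (summit = problem, D-0017)
set_option autoImplicit false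

namespace Summit.MatrixMultiplication.MatrixMultiplication.Theorems

open Finset

namespace FPQ

/-! ### Abelian groups of squarefree order are cyclic -/

/-- A finite abelian group of squarefree order is cyclic: its exponent divides the order, is divisible by every prime divisor of the order
(Cauchy), and a squarefree number divides any number divisible by all its primes. [folklore] -/
theorem isAddCyclic_of_squarefree_card {G : Type*} [AddCommGroup G] [Fintype G] (hsq : Squarefree (Fintype.card G)) : IsAddCyclic G := by
  apply IsAddCyclic.of_exponent_eq_card
  rw [Nat.card_eq_fintype_card]
  apply Nat.dvd_antisymm AddGroup.exponent_dvd_card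
  · have hE : AddMonoid.exponent G ≠ 0 := AddMonoid.ExponentExists.exponent_ne_zero AddMonoid.ExponentExists.of_finite
    have hC : Fintype.card G ≠ 0 := Fintype.card_ne_zero
    rw [← Nat.factorization_le_iff_dvd hC hE, Finsupp.le_def]
    intro r
    by_cases hr : r.Prime
    · by_cases hrd : r ∣ Fintype.card G
      · haveI : Fact r.Prime := ⟨hr⟩
        obtain ⟨x, hx⟩ := exists_prime_addOrderOf_dvd_card r hrd
        have hre : r ∣ AddMonoid.exponent G := hx ▸ AddMonoid.addOrder_dvd_exponent x
        have h1 : (Fintype.card G).factorization r ≤ 1 := hsq.natFactorization_le_one r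
        have h2 : 0 < (AddMonoid.exponent G).factorization r := hr.factorization_pos_of_dvd hE hre
        omega
      · rw [Nat.factorization_eq_zero_of_not_dvd hrd]; exact Nat.zero_le _
    · rw [Nat.factorization_eq_zero_of_not_prime _ hr]; exact Nat.zero_le _

/-! ### The quotient by a subgroup of order `p` is `ℤ/q` -/

variable {H : Type*} [AddCommGroup H] [Fintype H]

/-- **`|H| = q·p`, `p` prime, `q` squarefree ⇒ `H` has a subgroup `P` with `p` elements and `H ⧸ P ≃+ ℤ/q`** (Cauchy for `P`; the quotient is
abelian of squarefree order `q`, hence cyclic). [original] -/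
theorem exists_quotient_equiv_zmod {p q : ℕ} [NeZero q] (hM : Fintype.card H = q * p) (hp : p.Prime) (hq : Squarefree q) :
    ∃ P : AddSubgroup H, Nat.card P = p ∧ Nonempty (H ⧸ P ≃+ ZMod q) := by
  classical
  haveI : Fact p.Prime := ⟨hp⟩
  obtain ⟨g, hg⟩ := exists_prime_addOrderOf_dvd_card p (by rw [hM]; exact dvd_mul_left p q)
  set P : AddSubgroup H := AddSubgroup.zmultiples g with hPdef
  have hP : Nat.card P = p := by rw [hPdef, Nat.card_zmultiples, hg]
  -- the quotient has order `q`
  have hQ : Nat.card (H ⧸ P) = q := by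
    have h := AddSubgroup.card_eq_card_quotient_mul_card_addSubgroup P
    rw [Nat.card_eq_fintype_card, hM, hP] at h
    exact (Nat.eq_of_mul_eq_mul_right hp.pos h).symm
  letI : Fintype (H ⧸ P) := Fintype.ofFinite _
  have hQ' : Fintype.card (H ⧸ P) = q := by rw [← Nat.card_eq_fintype_card, hQ]
  have hcyc : IsAddCyclic (H ⧸ P) := isAddCyclic_of_squarefree_card (hQ' ▸ hq)
  exact ⟨P, hP, ⟨((ZMod.ringEquivCongr hQ).symm.toAddEquiv.trans (zmodAddCyclicAddEquiv hcyc)).symm⟩⟩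

/-! ### Soundness -/

open Literature.Computability.AlgebraicComplexity

variable {N : ℕ}

/-- **Soundness of rule FPq-cyc for squarefree `q`**: the shape data of every `IsSTPP` family with non-empty sets in a finite abelian group of
order `M` is `AdmC q M` — the general label-group theorem `FPQ.admG_of_isSTPP` at `Λ = ℤ/q` with the labelling of
`FPQ.exists_quotient_equiv_zmod`, read through `FPQ.admC_iff_admG`. [original] -/
theorem admC_of_isSTPP (q : ℕ) [NeZero q] (hq : Squarefree q) {A B C : Fin N → Finset H} (h : IsSTPP A B C)
    (hne : ∀ i, (A i).Nonempty ∧ (B i).Nonempty ∧ (C i).Nonempty) :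
    AdmC q (Fintype.card H) (fun i => (A i).card) (fun i => (B i).card) (fun i => (C i).card) := by
  classical
  rw [admC_iff_admG]
  intro p hM hp va vb vc hva hvb hvc
  rw [ZMod.card] at hM
  obtain ⟨P, hP, ⟨e⟩⟩ := exists_quotient_equiv_zmod (H := H) hM hp hq
  obtain ⟨L⟩ := nonempty_genLab P hP e
  have hM' : Fintype.card H = Fintype.card (ZMod q) * p := by rw [ZMod.card]; exact hM
  exact admG_of_isSTPP L h hne p hM' hp va vb vc hva hvb hvc

/-- **`FPqCycSound`** — the rule in the census's item format: for every squarefree `q`, every STPP family with non-empty sets in a finite abelian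
group `H` satisfies `AdmC q |H|` at its shape list. [original] -/
theorem fpqCycSound (q : ℕ) [NeZero q] (hq : Squarefree q) :
    ∀ (H : Type) [AddCommGroup H] [Fintype H] (N : ℕ) (A B C : Fin N → Finset H), IsSTPP A B C →
      (∀ i, (A i).Nonempty ∧ (B i).Nonempty ∧ (C i).Nonempty) →
        AdmC q (Fintype.card H) (fun i => (A i).card) (fun i => (B i).card) (fun i => (C i).card) := by
  intro H _ _ N A B C h hne
  exact admC_of_isSTPP q hq h hne

/-- **Semantic bridge for certificates**: if `AdmC q M a b c` fails for some squarefree `q` and all sizes are positive, then NO STPP family in a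
finite abelian group of order `M` has the size vectors `(a, b, c)` (cf. `FP4Wall604.no_isSTPP_of_not_fp4Adm`). [original] -/
theorem no_isSTPP_of_not_admC (q : ℕ) [NeZero q] (hq : Squarefree q) {M : ℕ} {a b c : Fin N → ℕ} (hk : ¬ AdmC q M a b c)
    (hpos : ∀ i, 0 < a i ∧ 0 < b i ∧ 0 < c i) :
    ∀ (H : Type) [AddCommGroup H] [Fintype H], Fintype.card H = M → ∀ (A B C : Fin N → Finset H), IsSTPP A B C →
      ¬ ((fun i => (A i).card) = a ∧ (fun i => (B i).card) = b ∧ (fun i => (C i).card) = c) := by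
  intro H _ _ hH A B C h hs
  obtain ⟨ha, hb, hc⟩ := hs
  have hne : ∀ i, (A i).Nonempty ∧ (B i).Nonempty ∧ (C i).Nonempty := fun i =>
    ⟨card_pos.mp (by rw [show (A i).card = a i from congrFun ha i]; exact (hpos i).1),
     card_pos.mp (by rw [show (B i).card = b i from congrFun hb i]; exact (hpos i).2.1),
     card_pos.mp (by rw [show (C i).card = c i from congrFun hc i]; exact (hpos i).2.2)⟩
  have hU := fpqCycSound q hq H N A B C h hne
  rw [hH, ha, hb, hc] at hU
  exact hk hU

end FPQ

end Summit.MatrixMultiplication.MatrixMultiplication.Theorems
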